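import Mathlib
import Literature.Probability.LatticeModels.EffectiveResistance
import Literature.Probability.LatticeModels.DomainDiscretisation
import Literature.Probability.RandomPlanarGeometry.PlanarDomains
import Literature.Analysis.Complex.ExtremalLength
import HarnessLib
import Literature.Probability.LatticeModels.DiscreteConductanceExtremalLength

/-!
# G02ModulusConvergence — MOVED (deprecated alias module)

Topic `Literature/Uncategorized`. The named fact parked here by the gate (accept-time relocation of a
`[cite]`d proposition written inline in
`Summits/CriticalPhenomena/CardyFormulaZ2/Theorems/CardyUSTContinuationKirchhoffExtremalLengthDefs.lean`,
human ruling 2026-08-15; sources: GeorgakopoulosPanagiotis2019) now lives, body byte-identical, at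
`Literature.Probability.LatticeModels.effectiveConductance_discreteArcs_tendsto_inv_extremalDistance`
(`Literature/Probability/LatticeModels/DiscreteConductanceExtremalLength.lean`, librarian move
2026-08-16, sweep g21). This module keeps only a deprecated reducible `abbrev` under the old name, so
that anything naming `Literature.Uncategorized.G02ModulusConvergence` keeps elaborating (no module
imports this one, checked 2026-08-16); it can be deleted by the operator. The original imports are
kept so that nothing downstream loses a transitive import.

* `Literature.Uncategorized.G02ModulusConvergence` — deprecated alias of
  `Literature.Probability.LatticeModels.effectiveConductance_discreteArcs_tendsto_inv_extremalDistance`.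
-/

namespace Literature.Uncategorized

/-- DEPRECATED alias (librarian move 2026-08-16): this constant is, by definition, the moved
`Literature.Probability.LatticeModels.effectiveConductance_discreteArcs_tendsto_inv_extremalDistance`
(statement byte-identical there: discrete conductance between the arcs of a conformal rectangle in
`Ω_δ` tends to the reciprocal extremal distance, [GP19] Cor. 4.15 rendering); kept as a reducible
`abbrev` so that files naming the old constant keep elaborating.
[cite: GeorgakopoulosPanagiotis2019, Corollary 4.15] -/
@[deprecated Literature.Probability.LatticeModels.effectiveConductance_discreteArcs_tendsto_inv_extremalDistance
  (since := "2026-08-16")]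
abbrev G02ModulusConvergence : Prop :=
  Literature.Probability.LatticeModels.effectiveConductance_discreteArcs_tendsto_inv_extremalDistance

end Literature.Uncategorized
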